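import Literature.Analysis.FluidPDE.CKNDuhamelTerms
import Literature.Analysis.FluidPDE.CaloricTestFieldCalculus
import Literature.Analysis.FluidPDE.CaloricDuhamelRepresentation
import Literature.Analysis.FluidPDE.NSBoundedCaloricDuality
import Literature.Analysis.FluidPDE.KNSSLemma31Liouville
import Literature.Analysis.FluidPDE.DistributionalToWeak
import Literature.Analysis.FluidPDE.HeatPotentialRepresentation
import Literature.Analysis.UnboundedOperators.HeatExtensionJointSmooth
import Mathlib.Analysis.Distribution.AEEqOfIntegralContDiff
import HarnessLib

/-!
# Jia–Šverák 2014, proof of Thm. 3.2: the localised Duhamel formula from the initial time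

Analysis/FluidPDE proofs file (theorems only, no new definitions, no new named facts), part of
the proof of the named fact `Literature.Analysis.FluidPDE.jia_sverak_2014_theorem_3_2`
(`JiaSverak2014LocalRegularity.lean`; H. Jia, V. Šverák, Invent. Math. 196 (2014) =
arXiv:1204.0529, §3 Thm. 3.2). The printed proof (arXiv p. 9) writes the solution near the initial
time as `u = u₁ + u₂ + u₃`,
`u₁ = ∫₀ᵗ e^{Δ(t-s)}[-div(u ⊗ u η) - ∇(pη)] ds`, `u₂ = e^{Δt}(u₀η)`, `u₃` caloric with zero datum.
Here the decomposition is obtained in one stroke and **by duality**, for the localised field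
`φu` (`φ` a space–time cut-off which may cross `t = 0`): the weak form of the equations *with the
initial datum* (the tree's `weakIdentity_datum_pressure_of_distributional`; Robinson–Rodrigo–
Sadowski 2016, §3.1 (3.1)) is tested with `ψ = (φη)c`, `η = 𝒰[θ]` the backward caloric Duhamel
integral of a test function `θ` (`∂ₜη + Δη = -θ`), exactly as in the tree's caloric duality
identity (`NSBoundedCaloricDuality.integral_cutoff_mul_test_mul_inner_eq`, Seregin–Šverák 2009
§2), but keeping the pressure term `φ p ∂_cη` as it is (no localisation of the pressure: the
pressure of this file is any function integrable up to `t = 0`, in the application the gauged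
pressure `p - c_{x₀}(t)`), and keeping the datum term `∫ ⟪u₀, ψ(0)⟫ = ∫ φ(0)u₀_c η(0)`. The
duality passage `∫ F η = ∫ θ̃ (W₊ ⊛ F)`, `∫ F ∂ᵥη = -∫ θ̃ Re(σᵥ(D)W₊ ⊛ F)`
(`CKNDuhamelTerms.lean`) and, for the datum, `∫ G η(0) = ∫∫_{s>0} θ (e^{sΔ}G)` (self-adjointness
of `e^{sΔ}`) then give, for a.e. `(t, x) ∈ (0,T) × ℝ³`,

  `φ u_c = W₊ ⊛ [(∂ₜφ + Δφ)u_c + ∂ᵢφ uᵢu_c + ∂_cφ p]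
          - Re ∂ᵢ-potentials of [2∂ᵢφ u_c + φuᵢu_c] - Re ∂_c-potential of [φp] + e^{tΔ}(φ(0)u₀)_c`

(`duhamel_representation_datum`): the printed `u₁` (the potentials of `φ`-data), `u₂`
(the caloric extension of the localised datum) and the commutator terms, which are smooth where
`φ ≡ 1` (the printed `u₃`).

* `integral_mul_heatDuhamelBack_zero_eq` — the datum pairing `∫ G 𝒰[θ](0) = ∫ θ̃ · 1_{t>0}e^{tΔ}G`;
* `duhamel_identity_datum_tested` — the identity tested against `θ`;
* `duhamel_representation_datum` — the a.e. representation.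

## References

* H. Jia, V. Šverák, Invent. Math. 196 (2014) = arXiv:1204.0529, §3, proof of Thm. 3.2 (p. 9).
  Bib key `JiaSverak2014`.
* J. C. Robinson, J. L. Rodrigo, W. Sadowski, *The Three-Dimensional Navier–Stokes Equations*
  (2016), §3.1 (3.1). Bib key `RobinsonRodrigoSadowski2016`.
* G. Seregin, V. Šverák, Comm. PDE 34 (2009) = arXiv:0804.1803, §2 (duality mechanism). Bib key
  `SereginSverak2009`.
-/

noncomputable section

open MeasureTheory TopologicalSpace Set Function Filter Metric
open _root_.Topology
open scoped ENNReal NNReal RealInnerProductSpace Laplacian Convolution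

namespace Literature.Analysis.FluidPDE

namespace JiaSverak2014

open Literature.Analysis.UnboundedOperators

/-! ### The datum pairing -/

set_option maxHeartbeats 800000 in
/-- **The datum pairing of the duality argument.** For a space–time test function `θ` and an
integrable bounded `G : ℝ³ → ℝ`,
`∫ G(x) 𝒰[θ](0, x) dx = ∫∫ θ(s, y) · (1_{s>0} e^{sΔ}G)(y) dy ds`
(`𝒰[θ](0) = ∫_{s>0} e^{sΔ}θ(s) ds`, Fubini, and the self-adjointness `∫ G e^{sΔ}h = ∫ (e^{sΔ}G) h`).
[folklore] -/
theorem integral_mul_heatDuhamelBack_zero_eq {θ : ℝ → (EuclideanSpace ℝ (Fin 3)) → ℝ}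
    (hθ : IsSpaceTimeTestOn (⊤ : Opens (ℝ × EuclideanSpace ℝ (Fin 3))) θ)
    {G : (EuclideanSpace ℝ (Fin 3)) → ℝ} (hGi : Integrable G volume) {M₀ : ℝ} (hGb : ∀ x, ‖G x‖ ≤ M₀) :
    ∫ x, G x * heatDuhamelBack 1 θ 0 x =
      ∫ w : ℝ × EuclideanSpace ℝ (Fin 3), θ w.1 w.2 * (if 0 < w.1 then heatExtension G w.1 w.2 else 0) := by
  obtain ⟨M, hM0, hM⟩ := hθ.exists_norm_le
  obtain ⟨a, b, hab⟩ := hθ.exists_time_support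
  have hM₀ : 0 ≤ M₀ := (norm_nonneg _).trans (hGb 0)
  -- the Duhamel integrand at `s = 0`
  set D : ℝ → (EuclideanSpace ℝ (Fin 3)) → ℝ := fun σ x => heatExtension (θ σ) σ x with hD
  have hD' : ∀ σ x, heatExtension (θ (0 + σ)) (1 * σ) x = D σ x := fun σ x => by
    simp only [hD, zero_add, one_mul]
  have h0 : ∀ x, heatDuhamelBack 1 θ 0 x = ∫ σ in Ioi 0, D σ x := fun x => by
    rw [heatDuhamelBack_apply]
    exact setIntegral_congr_fun measurableSet_Ioi fun σ _ => hD' σ x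
  -- continuity of `(σ, x) ↦ D σ x` on `σ > 0`, bound and vanishing
  have hDc : ContinuousOn (fun q : ℝ × EuclideanSpace ℝ (Fin 3) => D q.1 q.2) (Ioi 0 ×ˢ univ) := by
    have hc : Continuous fun q : ℝ × EuclideanSpace ℝ (Fin 3) => ((0 : ℝ), q.1, q.2) := by fun_prop
    have h := ContinuousOn.comp
      (g := fun p : ℝ × ℝ × EuclideanSpace ℝ (Fin 3) => heatExtension (θ (p.1 + p.2.1)) (1 * p.2.1) p.2.2)
      (f := fun q : ℝ × EuclideanSpace ℝ (Fin 3) => ((0 : ℝ), q.1, q.2))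
      (s := Ioi (0 : ℝ) ×ˢ (univ : Set (EuclideanSpace ℝ (Fin 3))))
      (hθ.continuousOn_duhamelIntegrand one_pos) hc.continuousOn
      (fun q hq => show (0 : ℝ) < q.1 from (mem_prod.1 hq).1)
    refine h.congr fun q _ => ?_
    simp only [Function.comp, hD, zero_add, one_mul]
  have hDb : ∀ σ x, 0 < σ → ‖D σ x‖ ≤ M := fun σ x hσ => by
    have h := norm_duhamelIntegrand_le (Θ := θ) hM one_pos hσ 0 x
    rwa [hD'] at h
  have hDz : ∀ σ x, b < σ → D σ x = 0 := fun σ x hσ => by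
    have h := duhamelIntegrand_eq_zero (ν := 1) (Θ := θ) hab (s := 0) (σ := σ) (by linarith) x
    rwa [hD'] at h
  -- ### Fubini for the left-hand side
  -- the product integrand `(x, σ) ↦ G x * D σ x` on `volume × volume|_{σ>0}`
  have hmeasD : AEStronglyMeasurable (fun q : (EuclideanSpace ℝ (Fin 3)) × ℝ => D q.2 q.1)
      ((volume : Measure (EuclideanSpace ℝ (Fin 3))).prod (volume.restrict (Ioi (0 : ℝ)))) := by
    have hswap : Continuous fun q : (EuclideanSpace ℝ (Fin 3)) × ℝ => ((q.2, q.1) : ℝ × EuclideanSpace ℝ (Fin 3)) := by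
      fun_prop
    have hc : ContinuousOn (fun q : (EuclideanSpace ℝ (Fin 3)) × ℝ => D q.2 q.1) (univ ×ˢ Ioi 0) :=
      ContinuousOn.comp (g := fun q : ℝ × EuclideanSpace ℝ (Fin 3) => D q.1 q.2)
        (f := fun q : (EuclideanSpace ℝ (Fin 3)) × ℝ => ((q.2, q.1) : ℝ × EuclideanSpace ℝ (Fin 3)))
        (s := (univ : Set (EuclideanSpace ℝ (Fin 3))) ×ˢ Ioi (0 : ℝ)) hDc hswap.continuousOn
        (fun q hq => mem_prod.2 ⟨(mem_prod.1 hq).2, mem_univ _⟩)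
    have hμ : ((volume : Measure (EuclideanSpace ℝ (Fin 3))).prod (volume.restrict (Ioi (0 : ℝ)))) =
        (volume.prod volume).restrict (univ ×ˢ Ioi 0) := by
      rw [← Measure.prod_restrict, Measure.restrict_univ]
    rw [hμ]
    exact hc.aestronglyMeasurable (MeasurableSet.univ.prod measurableSet_Ioi)
  have hprodL : Integrable (fun q : (EuclideanSpace ℝ (Fin 3)) × ℝ => G q.1 * D q.2 q.1)
      ((volume : Measure (EuclideanSpace ℝ (Fin 3))).prod (volume.restrict (Ioi (0 : ℝ)))) := by
    have hbound : Integrable (fun q : (EuclideanSpace ℝ (Fin 3)) × ℝ => ‖G q.1‖ * ((Ioc 0 b).indicator (fun _ => M) q.2))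
        ((volume : Measure (EuclideanSpace ℝ (Fin 3))).prod (volume.restrict (Ioi (0 : ℝ)))) := by
      refine Integrable.mul_prod hGi.norm ?_
      exact (integrable_indicator_iff measurableSet_Ioc).2 (integrableOn_const (by simp))
    refine hbound.mono' (hGi.aestronglyMeasurable.comp_fst.mul hmeasD) ?_
    -- the bound holds a.e. for the product measure (in `σ` a.e. on `Ioi 0`)
    have hae : ∀ᵐ q ∂((volume : Measure (EuclideanSpace ℝ (Fin 3))).prod (volume.restrict (Ioi (0 : ℝ)))), 0 < q.2 := by
      refine (Measure.ae_prod_iff_ae_ae ?_).2 (Eventually.of_forall fun x => ae_restrict_mem measurableSet_Ioi)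
      exact measurableSet_lt measurable_const measurable_snd
    filter_upwards [hae] with q hq
    rw [norm_mul]
    by_cases hb : q.2 ≤ b
    · rw [indicator_of_mem (show q.2 ∈ Ioc (0 : ℝ) b from ⟨hq, hb⟩)]
      exact mul_le_mul_of_nonneg_left (hDb _ _ hq) (norm_nonneg _)
    · rw [hDz _ _ (not_le.1 hb), norm_zero, mul_zero]
      exact mul_nonneg (norm_nonneg _) (indicator_nonneg (fun _ _ => hM0) _)
  have hLHS : ∫ x, G x * heatDuhamelBack 1 θ 0 x = ∫ σ in Ioi 0, ∫ x, G x * D σ x := by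
    have h1 : ∀ x, G x * heatDuhamelBack 1 θ 0 x = ∫ σ in Ioi 0, G x * D σ x := fun x => by
      rw [h0 x, ← integral_const_mul]
    simp_rw [h1]
    exact integral_integral_swap hprodL
  -- ### the self-adjointness on each slice
  have hslice : ∀ σ, 0 < σ → ∫ x, G x * D σ x = ∫ x, heatExtension G σ x * θ σ x := fun σ hσ => by
    have hmem : MemLp (θ σ) ∞ (volume : Measure (EuclideanSpace ℝ (Fin 3))) :=
      memLp_top_of_bound (hθ.contDiff_slice σ).continuous.aestronglyMeasurable M
        (Eventually.of_forall fun x => hM σ x)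
    exact integral_mul_heatExtension_eq_of_top hmem hGi hσ
  rw [hLHS, setIntegral_congr_fun measurableSet_Ioi fun σ hσ => hslice σ hσ]
  -- ### Fubini for the right-hand side
  have hGmem : MemLp G 1 (volume : Measure (EuclideanSpace ℝ (Fin 3))) := memLp_one_iff_integrable.2 hGi
  have hEc : ContinuousOn (fun q : ℝ × EuclideanSpace ℝ (Fin 3) => heatExtension G q.1 q.2) (Ioi 0 ×ˢ univ) :=
    (contDiffOn_heatExtension_prod hGmem le_rfl).continuousOn
  have hEb : ∀ σ x, 0 < σ → ‖heatExtension G σ x‖ ≤ M₀ := fun σ x hσ => norm_heatExtension_le hGb hσ x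
  have hSm : MeasurableSet (Ioi (0 : ℝ) ×ˢ (univ : Set (EuclideanSpace ℝ (Fin 3)))) := measurableSet_Ioi.prod MeasurableSet.univ
  have hθi : Integrable (uncurry θ) (volume : Measure (ℝ × EuclideanSpace ℝ (Fin 3))) := hθ.integrable_uncurry
  have hint : IntegrableOn (fun w : ℝ × EuclideanSpace ℝ (Fin 3) => heatExtension G w.1 w.2 * θ w.1 w.2)
      (Ioi 0 ×ˢ univ) volume := by
    have hmeas : AEStronglyMeasurable (fun w : ℝ × EuclideanSpace ℝ (Fin 3) => heatExtension G w.1 w.2 * θ w.1 w.2)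
        (volume.restrict (Ioi 0 ×ˢ univ)) :=
      (hEc.aestronglyMeasurable hSm).mul (hθi.aestronglyMeasurable.restrict)
    refine Integrable.mono' ((hθi.norm.restrict).const_mul M₀) hmeas ?_
    filter_upwards [ae_restrict_mem hSm] with w hw
    rw [norm_mul]
    calc ‖heatExtension G w.1 w.2‖ * ‖θ w.1 w.2‖ ≤ M₀ * ‖θ w.1 w.2‖ :=
          mul_le_mul_of_nonneg_right (hEb _ _ hw.1) (norm_nonneg _)
      _ = M₀ * ‖uncurry θ w‖ := rfl
  have hRHS : ∫ w : ℝ × EuclideanSpace ℝ (Fin 3), θ w.1 w.2 * (if 0 < w.1 then heatExtension G w.1 w.2 else 0) =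
      ∫ w in Ioi (0 : ℝ) ×ˢ (univ : Set (EuclideanSpace ℝ (Fin 3))), heatExtension G w.1 w.2 * θ w.1 w.2 := by
    rw [← integral_indicator hSm]
    refine integral_congr_ae (Eventually.of_forall fun w => ?_)
    show θ w.1 w.2 * (if 0 < w.1 then heatExtension G w.1 w.2 else 0) =
      (Ioi (0 : ℝ) ×ˢ (univ : Set (EuclideanSpace ℝ (Fin 3)))).indicator (fun w => heatExtension G w.1 w.2 * θ w.1 w.2) w
    by_cases hw : 0 < w.1
    · rw [if_pos hw, indicator_of_mem (show w ∈ Ioi (0 : ℝ) ×ˢ (univ : Set (EuclideanSpace ℝ (Fin 3))) from ⟨hw, mem_univ _⟩)]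
      ring
    · rw [if_neg hw, mul_zero, indicator_of_notMem (fun h => hw h.1)]
  rw [hRHS]
  have hprod : (volume.restrict (Ioi (0 : ℝ) ×ˢ (univ : Set (EuclideanSpace ℝ (Fin 3)))) : Measure (ℝ × EuclideanSpace ℝ (Fin 3))) =
      (volume.restrict (Ioi (0 : ℝ))).prod (volume : Measure (EuclideanSpace ℝ (Fin 3))) := by
    rw [Measure.volume_eq_prod, Measure.restrict_prod_eq_prod_univ]
  have hint' : Integrable (fun w : ℝ × EuclideanSpace ℝ (Fin 3) => heatExtension G w.1 w.2 * θ w.1 w.2)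
      ((volume.restrict (Ioi (0 : ℝ))).prod (volume : Measure (EuclideanSpace ℝ (Fin 3)))) := by
    rw [← hprod]; exact hint
  rw [hprod, integral_prod _ hint']

/-! ### The identity tested against a test function -/

set_option maxHeartbeats 3200000 in
/-- **The localised Duhamel formula from the initial time, tested against `θ`.** Let `T > 0` and
let `(u, p)` satisfy the weak form of the unit-viscosity unforced Navier–Stokes equations on
`(0,T) × ℝ³` **with initial datum `u₀`** against every test field on `(-∞, T) × ℝ³` (the conclusion
of the tree's `weakIdentity_datum_pressure_of_distributional`); let `us`, `ps` be functions on
`ℝ × ℝ³` agreeing with `u`, `p` on the slab `S = (0,T) × ℝ³`, vanishing off it, with `us, |us|², ps`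
locally integrable; let `φ` be a test function on `(-∞, T) × ℝ³` (it may cross `t = 0`) with
`φ(0)u₀` bounded, `c ∈ ℝ³`, and `θ` a space–time test function. Then (`η = 𝒰[θ]`)
`∫_S θ φ u_c = ∫ θ̃ W₊⊛[(∂ₜφ+Δφ)us_c] + ∑ᵢ ∫ θ̃ (-Re σᵢ(D)W₊⊛[2∂ᵢφ us_c]) + ∑ᵢ ∫ θ̃ W₊⊛[∂ᵢφ usᵢus_c]
 + ∑ᵢ ∫ θ̃ (-Re σᵢ(D)W₊⊛[φ usᵢus_c]) + ∫ θ̃ W₊⊛[∂_cφ ps] + ∫ θ̃ (-Re σ_c(D)W₊⊛[φ ps]) + ∫ θ̃ 1_{t>0}e^{tΔ}(φ(0)u₀_c)`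
(the weak form tested with `ψ = (φη)c`, the backward heat equation `∂ₜη + Δη = -θ`, and the
duality passages of `CKNDuhamelTerms.lean` and `integral_mul_heatDuhamelBack_zero_eq`).
[cite: JiaSverak2014, §3 proof of Thm. 3.2 (arXiv p. 9)] [cite: SereginSverak2009, §2] -/
theorem duhamel_identity_datum_tested {T : ℝ}
    {u : ℝ → (EuclideanSpace ℝ (Fin 3)) → (EuclideanSpace ℝ (Fin 3))} {p : ℝ → (EuclideanSpace ℝ (Fin 3)) → ℝ}
    {u₀ : (EuclideanSpace ℝ (Fin 3)) → (EuclideanSpace ℝ (Fin 3))}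
    {us : ℝ × (EuclideanSpace ℝ (Fin 3)) → (EuclideanSpace ℝ (Fin 3))} {ps : ℝ × (EuclideanSpace ℝ (Fin 3)) → ℝ}
    (hus : ∀ᵐ z ∂(volume : Measure (ℝ × EuclideanSpace ℝ (Fin 3))),
      z ∈ Ioo 0 T ×ˢ (univ : Set (EuclideanSpace ℝ (Fin 3))) → us z = u z.1 z.2)
    (hus0 : ∀ z, z ∉ Ioo 0 T ×ˢ (univ : Set (EuclideanSpace ℝ (Fin 3))) → us z = 0)
    (husi : LocallyIntegrable us volume) (hus2 : LocallyIntegrable (fun z => ‖us z‖ ^ 2) volume)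
    (hps : ∀ᵐ z ∂(volume : Measure (ℝ × EuclideanSpace ℝ (Fin 3))),
      z ∈ Ioo 0 T ×ˢ (univ : Set (EuclideanSpace ℝ (Fin 3))) → ps z = p z.1 z.2)
    (hps0 : ∀ z, z ∉ Ioo 0 T ×ˢ (univ : Set (EuclideanSpace ℝ (Fin 3))) → ps z = 0)
    (hpsi : LocallyIntegrable ps volume)
    (hweak : ∀ ψ : ℝ → (EuclideanSpace ℝ (Fin 3)) → (EuclideanSpace ℝ (Fin 3)),
      IsSpaceTimeTestOn (slab (EuclideanSpace ℝ (Fin 3)) (Iio T) isOpen_Iio) ψ →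
      (∫ t in Ioo 0 T, ∫ x, (⟪u t x, timeDeriv ψ t x⟫ + ⟪u t x, convect (u t) (ψ t) x⟫ +
          1 * ⟪u t x, Δ (ψ t) x⟫ + p t x * VectorCalculus.divergence (ψ t) x)) +
        ∫ x, ⟪u₀ x, ψ 0 x⟫ = 0)
    (hu₀ : AEStronglyMeasurable u₀ volume)
    {φ : ℝ → (EuclideanSpace ℝ (Fin 3)) → ℝ} (hφ : IsSpaceTimeTestOn (slab (EuclideanSpace ℝ (Fin 3)) (Iio T) isOpen_Iio) φ)
    {M₀ : ℝ} (hu₀b : ∀ x, ‖φ 0 x • u₀ x‖ ≤ M₀)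
    (c : EuclideanSpace ℝ (Fin 3)) {θ : ℝ → (EuclideanSpace ℝ (Fin 3)) → ℝ}
    (hθ : IsSpaceTimeTestOn (⊤ : Opens (ℝ × EuclideanSpace ℝ (Fin 3))) θ) :
    ∫ z in Ioo 0 T ×ˢ (univ : Set (EuclideanSpace ℝ (Fin 3))), θ z.1 z.2 * (φ z.1 z.2 * ⟪u z.1 z.2, c⟫) =
      (∫ w : ℝ × EuclideanSpace ℝ (Fin 3), θ w.1 w.2 * heatPotential 1 (fun z : ℝ × EuclideanSpace ℝ (Fin 3) =>
          (timeDeriv φ z.1 z.2 + (Δ (φ z.1)) z.2) * ⟪us z, c⟫) w)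
      + (∑ i, ∫ w : ℝ × EuclideanSpace ℝ (Fin 3), θ w.1 w.2 *
          (-(multiplierHeatPotential 1 (derivSymbol (EuclideanSpace.basisFun (Fin 3) ℝ i))
            (fun z : ℝ × EuclideanSpace ℝ (Fin 3) =>
              (2 * fderiv ℝ (φ z.1) z.2 (EuclideanSpace.basisFun (Fin 3) ℝ i)) * ⟪us z, c⟫) w).re))
      + (∑ i, ∫ w : ℝ × EuclideanSpace ℝ (Fin 3), θ w.1 w.2 * heatPotential 1 (fun z : ℝ × EuclideanSpace ℝ (Fin 3) =>
          fderiv ℝ (φ z.1) z.2 (EuclideanSpace.basisFun (Fin 3) ℝ i) *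
            (⟪us z, EuclideanSpace.basisFun (Fin 3) ℝ i⟫ * ⟪us z, c⟫)) w)
      + (∑ i, ∫ w : ℝ × EuclideanSpace ℝ (Fin 3), θ w.1 w.2 *
          (-(multiplierHeatPotential 1 (derivSymbol (EuclideanSpace.basisFun (Fin 3) ℝ i))
            (fun z : ℝ × EuclideanSpace ℝ (Fin 3) =>
              φ z.1 z.2 * (⟪us z, EuclideanSpace.basisFun (Fin 3) ℝ i⟫ * ⟪us z, c⟫)) w).re))
      + (∫ w : ℝ × EuclideanSpace ℝ (Fin 3), θ w.1 w.2 * heatPotential 1 (fun z : ℝ × EuclideanSpace ℝ (Fin 3) =>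
          fderiv ℝ (φ z.1) z.2 c * ps z) w)
      + (∫ w : ℝ × EuclideanSpace ℝ (Fin 3), θ w.1 w.2 *
          (-(multiplierHeatPotential 1 (derivSymbol c) (fun z : ℝ × EuclideanSpace ℝ (Fin 3) => φ z.1 z.2 * ps z) w).re))
      + (∫ w : ℝ × EuclideanSpace ℝ (Fin 3), θ w.1 w.2 *
          (if 0 < w.1 then heatExtension (fun y => φ 0 y * ⟪u₀ y, c⟫) w.1 w.2 else 0)) := by
  classical
  /- ### notation and basic objects -/
  set b : OrthonormalBasis (Fin 3) ℝ (EuclideanSpace ℝ (Fin 3)) := EuclideanSpace.basisFun (Fin 3) ℝ with hb_def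
  set S : Set (ℝ × EuclideanSpace ℝ (Fin 3)) := Ioo 0 T ×ˢ (univ : Set (EuclideanSpace ℝ (Fin 3))) with hS_def
  have hSm : MeasurableSet S := measurableSet_Ioo.prod MeasurableSet.univ
  set K : Set (ℝ × EuclideanSpace ℝ (Fin 3)) := tsupport (uncurry φ) with hK_def
  have hK : IsCompact K := hφ.hasCompactSupport
  -- the caloric test field
  set η : ℝ → EuclideanSpace ℝ (Fin 3) → ℝ := heatDuhamelBack 1 θ with hη
  have hηs : ContDiff ℝ ((⊤ : ℕ∞) : WithTop ℕ∞) (uncurry η) := by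
    rw [hη]; exact hθ.contDiff_uncurry_heatDuhamelBack_infty one_pos
  have heat : ∀ t x, timeDeriv η t x + (Δ (η t)) x = -θ t x := fun t x => by
    rw [hη]; exact timeDeriv_add_laplacian_heatDuhamelBack_one hθ t x
  /- ### continuity of the factors -/
  have cφ : Continuous fun z : ℝ × EuclideanSpace ℝ (Fin 3) => φ z.1 z.2 := hφ.contDiff.continuous
  have cφt : Continuous fun z : ℝ × EuclideanSpace ℝ (Fin 3) => timeDeriv φ z.1 z.2 := hφ.continuous_timeDeriv
  have cφΔ : Continuous fun z : ℝ × EuclideanSpace ℝ (Fin 3) => (Δ (φ z.1)) z.2 := by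
    have h := ((hφ.isSmoothSpaceTimeOn univ).laplacian uniqueDiffOn_univ).continuousOn
    rw [univ_prod_univ, continuousOn_univ] at h
    exact h
  have cφi : ∀ v : EuclideanSpace ℝ (Fin 3),
      Continuous fun z : ℝ × EuclideanSpace ℝ (Fin 3) => fderiv ℝ (φ z.1) z.2 v := fun v =>
    continuous_fderiv_slice_of_contDiff hφ.contDiff v
  have cη : Continuous fun z : ℝ × EuclideanSpace ℝ (Fin 3) => η z.1 z.2 := hηs.continuous
  have cηi : ∀ v : EuclideanSpace ℝ (Fin 3),
      Continuous fun z : ℝ × EuclideanSpace ℝ (Fin 3) => fderiv ℝ (η z.1) z.2 v := fun v =>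
    continuous_fderiv_slice_of_contDiff hηs v
  have cθ : Continuous fun z : ℝ × EuclideanSpace ℝ (Fin 3) => θ z.1 z.2 := hθ.contDiff.continuous
  have cone : Continuous fun _ : ℝ × EuclideanSpace ℝ (Fin 3) => (1 : ℝ) := continuous_const
  /- ### vanishing of the cut-off factors off `K` -/
  have zφ : ∀ z : ℝ × EuclideanSpace ℝ (Fin 3), z ∉ K → φ z.1 z.2 = 0 := fun z hz =>
    show uncurry φ z = 0 from image_eq_zero_of_notMem_tsupport hz
  have zφt : ∀ z : ℝ × EuclideanSpace ℝ (Fin 3), z ∉ K → timeDeriv φ z.1 z.2 + (Δ (φ z.1)) z.2 = 0 :=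
    fun z hz => by
    rw [IsSpaceTimeTestOn.timeDeriv_eq_zero_of_notMem hz, laplacian_slice_eq_zero_of_notMem_tsupport hz,
      add_zero]
  have zφi : ∀ (v : EuclideanSpace ℝ (Fin 3)) (z : ℝ × EuclideanSpace ℝ (Fin 3)), z ∉ K →
      fderiv ℝ (φ z.1) z.2 v = 0 := fun v z hz => by
    rw [IsSpaceTimeTestOn.fderiv_slice_eq_zero_of_notMem hz]; rfl
  /- ### integrability of the basic monomials on `K` -/
  have mu : ∀ a : EuclideanSpace ℝ (Fin 3),
      IntegrableOn (fun z : ℝ × EuclideanSpace ℝ (Fin 3) => ⟪us z, a⟫) K volume := fun a =>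
    (husi.integrableOn_isCompact hK).inner_const a
  have muu : ∀ a a' : EuclideanSpace ℝ (Fin 3), IntegrableOn
      (fun z : ℝ × EuclideanSpace ℝ (Fin 3) => ⟪us z, a⟫ * ⟪us z, a'⟫) K volume := by
    intro a a'
    have hm : AEStronglyMeasurable (fun z : ℝ × EuclideanSpace ℝ (Fin 3) => ⟪us z, a⟫ * ⟪us z, a'⟫)
        (volume.restrict K) := by
      have h := (husi.integrableOn_isCompact hK).aestronglyMeasurable
      exact (h.inner_const (c := a)).mul (h.inner_const (c := a'))
    refine (((hus2.integrableOn_isCompact hK)).const_mul (‖a‖ * ‖a'‖)).mono' hm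
      (Eventually.of_forall fun z => ?_)
    rw [norm_mul]
    calc ‖(⟪us z, a⟫ : ℝ)‖ * ‖(⟪us z, a'⟫ : ℝ)‖ ≤ (‖us z‖ * ‖a‖) * (‖us z‖ * ‖a'‖) :=
          mul_le_mul (norm_inner_le_norm _ _) (norm_inner_le_norm _ _) (norm_nonneg _) (by positivity)
      _ = ‖a‖ * ‖a'‖ * ‖us z‖ ^ 2 := by ring
  have mp : IntegrableOn ps K volume := hpsi.integrableOn_isCompact hK
  -- a generic integrability statement on the whole space
  have INT : ∀ {Tc m X : ℝ × EuclideanSpace ℝ (Fin 3) → ℝ}, Continuous Tc → (∀ z, z ∉ K → Tc z = 0) →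
      IntegrableOn m K volume → Continuous X →
      Integrable (fun z => Tc z * m z * X z) volume := by
    intro Tc m X hTc hTc0 hm hX
    have h := integrableOn_test_mul_mul (⊤ : Opens (ℝ × EuclideanSpace ℝ (Fin 3))) hK hTc hTc0 hm hX
    rwa [TopologicalSpace.Opens.coe_top, integrableOn_univ] at h
  /- ### the weak form tested with `ψ = (φη)c` -/
  set ψ : ℝ → EuclideanSpace ℝ (Fin 3) → EuclideanSpace ℝ (Fin 3) := fun t x => (φ t x * η t x) • c
    with hψ_def
  have hψ : IsSpaceTimeTestOn (slab (EuclideanSpace ℝ (Fin 3)) (Iio T) isOpen_Iio) ψ :=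
    (hφ.mul_smooth hηs).smul_const' c
  have key := hweak ψ hψ
  -- the pointwise integrands (in terms of `us`, `ps`)
  set AV : ℝ × EuclideanSpace ℝ (Fin 3) → ℝ := fun z =>
    (timeDeriv φ z.1 z.2 + (Δ (φ z.1)) z.2) * ⟪us z, c⟫ * η z.1 z.2
      + ∑ i, (2 * fderiv ℝ (φ z.1) z.2 (b i)) * ⟪us z, c⟫ * fderiv ℝ (η z.1) z.2 (b i)
      + ∑ i, fderiv ℝ (φ z.1) z.2 (b i) * (⟪us z, b i⟫ * ⟪us z, c⟫) * η z.1 z.2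
      + ∑ i, φ z.1 z.2 * (⟪us z, b i⟫ * ⟪us z, c⟫) * fderiv ℝ (η z.1) z.2 (b i)
      + fderiv ℝ (φ z.1) z.2 c * ps z * η z.1 z.2 with hAV
  set P6 : ℝ × EuclideanSpace ℝ (Fin 3) → ℝ := fun z => φ z.1 z.2 * ps z * fderiv ℝ (η z.1) z.2 c with hP6
  set LH : ℝ × EuclideanSpace ℝ (Fin 3) → ℝ := fun z => φ z.1 z.2 * θ z.1 z.2 * ⟪us z, c⟫ with hLH
  -- the pointwise identity on the slab
  have hptV : ∀ z ∈ S, us z = u z.1 z.2 → ps z = p z.1 z.2 →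
      ⟪u z.1 z.2, timeDeriv ψ z.1 z.2⟫ + ⟪u z.1 z.2, convect (u z.1) (ψ z.1) z.2⟫ +
        1 * ⟪u z.1 z.2, (Δ (ψ z.1)) z.2⟫ + p z.1 z.2 * VectorCalculus.divergence (ψ z.1) z.2 =
      AV z + P6 z - LH z := by
    rintro ⟨t, x⟩ _ hu' hp'
    have e1 : timeDeriv ψ t x = (timeDeriv φ t x * η t x + φ t x * timeDeriv η t x) • c :=
      timeDeriv_mulSmul hφ.contDiff hηs c t x
    have e2 : convect (u t) (ψ t) x =
        (fderiv ℝ (φ t) x (u t x) * η t x + φ t x * fderiv ℝ (η t) x (u t x)) • c :=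
      convect_mulSmul hφ.contDiff hηs c (u t) t x
    have e3 : (Δ (ψ t)) x = (φ t x * (Δ (η t)) x + η t x * (Δ (φ t)) x +
        2 * ∑ i, fderiv ℝ (φ t) x (b i) * fderiv ℝ (η t) x (b i)) • c :=
      laplacian_mulSmul b hφ.contDiff hηs c t x
    have e4 : VectorCalculus.divergence (ψ t) x = fderiv ℝ (φ t) x c * η t x + φ t x * fderiv ℝ (η t) x c :=
      divergence_mulSmul hφ.contDiff hηs c t x
    have e5 : fderiv ℝ (φ t) x (u t x) = ∑ i, ⟪u t x, b i⟫ * fderiv ℝ (φ t) x (b i) :=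
      fderiv_apply_eq_sum_inner b (φ t) x (u t x)
    have e6 : fderiv ℝ (η t) x (u t x) = ∑ i, ⟪u t x, b i⟫ * fderiv ℝ (η t) x (b i) :=
      fderiv_apply_eq_sum_inner b (η t) x (u t x)
    have e7 := heat t x
    simp only [hAV, hP6, hLH, hu', hp']
    rw [e1, e2, e3, e4]
    simp only [real_inner_smul_right, one_mul]
    have E3 : 2 * (∑ i, fderiv ℝ (φ t) x (b i) * fderiv ℝ (η t) x (b i)) * ⟪u t x, c⟫ =
        ∑ i, 2 * fderiv ℝ (φ t) x (b i) * ⟪u t x, c⟫ * fderiv ℝ (η t) x (b i) := by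
      rw [Finset.mul_sum, Finset.sum_mul]
      exact Finset.sum_congr rfl fun i _ => by ring
    have E5 : fderiv ℝ (φ t) x (u t x) * η t x * ⟪u t x, c⟫ =
        ∑ i, fderiv ℝ (φ t) x (b i) * (⟪u t x, b i⟫ * ⟪u t x, c⟫) * η t x := by
      rw [e5, Finset.sum_mul, Finset.sum_mul]
      exact Finset.sum_congr rfl fun i _ => by ring
    have E6 : φ t x * fderiv ℝ (η t) x (u t x) * ⟪u t x, c⟫ =
        ∑ i, φ t x * (⟪u t x, b i⟫ * ⟪u t x, c⟫) * fderiv ℝ (η t) x (b i) := by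
      rw [e6, Finset.mul_sum, Finset.sum_mul]
      exact Finset.sum_congr rfl fun i _ => by ring
    linear_combination (φ t x * ⟪u t x, c⟫) * e7 + E5 + E6 + E3
  have hptV' : ∀ᵐ z ∂(volume.restrict S),
      ⟪u z.1 z.2, timeDeriv ψ z.1 z.2⟫ + ⟪u z.1 z.2, convect (u z.1) (ψ z.1) z.2⟫ +
        1 * ⟪u z.1 z.2, (Δ (ψ z.1)) z.2⟫ + p z.1 z.2 * VectorCalculus.divergence (ψ z.1) z.2 =
      AV z + P6 z - LH z := by
    rw [ae_restrict_iff' hSm]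
    filter_upwards [hus, hps] with z hzu hzp hzS
    exact hptV z hzS (hzu hzS) (hzp hzS)
  /- ### integrability of every term on the whole space -/
  have iLH : Integrable LH volume := by
    have h := INT cφ zφ (mu c) cθ
    refine h.congr (Eventually.of_forall fun z => ?_)
    simp only [hLH]; ring
  have iP6 : Integrable P6 volume := INT cφ zφ mp (cηi c)
  have iA1 : Integrable (fun z : ℝ × EuclideanSpace ℝ (Fin 3) =>
      (timeDeriv φ z.1 z.2 + (Δ (φ z.1)) z.2) * ⟪us z, c⟫ * η z.1 z.2) volume :=
    INT (cφt.add cφΔ) zφt (mu c) cη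
  have iA2 : ∀ i, Integrable (fun z : ℝ × EuclideanSpace ℝ (Fin 3) =>
      (2 * fderiv ℝ (φ z.1) z.2 (b i)) * ⟪us z, c⟫ * fderiv ℝ (η z.1) z.2 (b i)) volume := fun i =>
    INT (continuous_const.mul (cφi (b i))) (fun z hz => by rw [zφi (b i) z hz, mul_zero]) (mu c) (cηi (b i))
  have iA3 : ∀ i, Integrable (fun z : ℝ × EuclideanSpace ℝ (Fin 3) =>
      fderiv ℝ (φ z.1) z.2 (b i) * (⟪us z, b i⟫ * ⟪us z, c⟫) * η z.1 z.2) volume := fun i =>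
    INT (cφi (b i)) (zφi (b i)) (muu (b i) c) cη
  have iA4 : ∀ i, Integrable (fun z : ℝ × EuclideanSpace ℝ (Fin 3) =>
      φ z.1 z.2 * (⟪us z, b i⟫ * ⟪us z, c⟫) * fderiv ℝ (η z.1) z.2 (b i)) volume := fun i =>
    INT cφ zφ (muu (b i) c) (cηi (b i))
  have iA5 : Integrable (fun z : ℝ × EuclideanSpace ℝ (Fin 3) =>
      fderiv ℝ (φ z.1) z.2 c * ps z * η z.1 z.2) volume := INT (cφi c) (zφi c) mp cη
  have iA2s : Integrable (fun z : ℝ × EuclideanSpace ℝ (Fin 3) =>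
      ∑ i, (2 * fderiv ℝ (φ z.1) z.2 (b i)) * ⟪us z, c⟫ * fderiv ℝ (η z.1) z.2 (b i)) volume :=
    integrable_finsetSum _ fun i _ => iA2 i
  have iA3s : Integrable (fun z : ℝ × EuclideanSpace ℝ (Fin 3) =>
      ∑ i, fderiv ℝ (φ z.1) z.2 (b i) * (⟪us z, b i⟫ * ⟪us z, c⟫) * η z.1 z.2) volume :=
    integrable_finsetSum _ fun i _ => iA3 i
  have iA4s : Integrable (fun z : ℝ × EuclideanSpace ℝ (Fin 3) =>
      ∑ i, φ z.1 z.2 * (⟪us z, b i⟫ * ⟪us z, c⟫) * fderiv ℝ (η z.1) z.2 (b i)) volume :=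
    integrable_finsetSum _ fun i _ => iA4 i
  have iAV : Integrable AV volume := (((iA1.fun_add iA2s).fun_add iA3s).fun_add iA4s).fun_add iA5
  /- ### the space–time integral of the weak form as an integral over the slab -/
  set W : ℝ × EuclideanSpace ℝ (Fin 3) → ℝ := fun z =>
    ⟪u z.1 z.2, timeDeriv ψ z.1 z.2⟫ + ⟪u z.1 z.2, convect (u z.1) (ψ z.1) z.2⟫ +
      1 * ⟪u z.1 z.2, (Δ (ψ z.1)) z.2⟫ + p z.1 z.2 * VectorCalculus.divergence (ψ z.1) z.2 with hW
  have iWS : IntegrableOn W S volume :=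
    ((Integrable.sub (iAV.add iP6) iLH).integrableOn).congr_fun_ae (hptV'.mono fun z hz => hz.symm)
  have hprod : (volume.restrict S : Measure (ℝ × EuclideanSpace ℝ (Fin 3))) =
      ((volume : Measure ℝ).restrict (Ioo 0 T)).prod (volume : Measure (EuclideanSpace ℝ (Fin 3))) := by
    rw [hS_def]; exact volume_restrict_slab_eq T
  have hiter : (∫ t in Ioo 0 T, ∫ x, (⟪u t x, timeDeriv ψ t x⟫ + ⟪u t x, convect (u t) (ψ t) x⟫ +
      1 * ⟪u t x, Δ (ψ t) x⟫ + p t x * VectorCalculus.divergence (ψ t) x)) = ∫ z in S, W z := by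
    have iW' : Integrable W (((volume : Measure ℝ).restrict (Ioo 0 T)).prod (volume : Measure (EuclideanSpace ℝ (Fin 3)))) := by
      rw [← hprod]; exact iWS
    have e : (∫ z in S, W z) = ∫ t in Ioo 0 T, ∫ x, W (t, x) := by
      rw [show (volume.restrict S : Measure (ℝ × EuclideanSpace ℝ (Fin 3))) = _ from hprod, integral_prod W iW']
    rw [e]
  -- the datum term
  set G : (EuclideanSpace ℝ (Fin 3)) → ℝ := fun y => φ 0 y * ⟪u₀ y, c⟫ with hG
  have hdat : ∫ x, ⟪u₀ x, ψ 0 x⟫ = ∫ x, G x * η 0 x := by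
    refine integral_congr_ae (Eventually.of_forall fun x => ?_)
    simp only [hψ_def, hG, real_inner_smul_right]
    ring
  -- assemble: `∫ LH = ∫ AV + ∫ P6 + ∫ G η(0)`
  have vAV : ∀ z, z ∉ S → AV z = 0 := fun z hz => by
    simp only [hAV, hus0 z hz, hps0 z hz, inner_zero_left, mul_zero, zero_mul, Finset.sum_const_zero, add_zero]
  have vP6 : ∀ z, z ∉ S → P6 z = 0 := fun z hz => by simp only [hP6, hps0 z hz, mul_zero, zero_mul]
  have vLH : ∀ z, z ∉ S → LH z = 0 := fun z hz => by simp only [hLH, hus0 z hz, inner_zero_left, mul_zero]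
  have hWS : ∫ z in S, W z = (∫ z, AV z) + (∫ z, P6 z) - ∫ z, LH z := by
    have h1 : ∫ z in S, W z = ∫ z in S, (AV z + P6 z - LH z) :=
      integral_congr_ae hptV'
    rw [h1, integral_sub (iAV.fun_add iP6).integrableOn iLH.integrableOn, integral_add iAV.integrableOn iP6.integrableOn,
      setIntegral_eq_integral_of_forall_compl_eq_zero fun z hz => vAV z hz,
      setIntegral_eq_integral_of_forall_compl_eq_zero fun z hz => vP6 z hz,
      setIntegral_eq_integral_of_forall_compl_eq_zero fun z hz => vLH z hz]
  rw [hiter, hWS, hdat] at key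
  have main : ∫ z, LH z = (∫ z, AV z) + (∫ z, P6 z) + ∫ x, G x * η 0 x := by linarith
  -- expand `∫ AV`
  have hA : ∫ z, AV z =
      (∫ z, (timeDeriv φ z.1 z.2 + (Δ (φ z.1)) z.2) * ⟪us z, c⟫ * η z.1 z.2)
      + (∑ i, ∫ z, (2 * fderiv ℝ (φ z.1) z.2 (b i)) * ⟪us z, c⟫ * fderiv ℝ (η z.1) z.2 (b i))
      + (∑ i, ∫ z, fderiv ℝ (φ z.1) z.2 (b i) * (⟪us z, b i⟫ * ⟪us z, c⟫) * η z.1 z.2)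
      + (∑ i, ∫ z, φ z.1 z.2 * (⟪us z, b i⟫ * ⟪us z, c⟫) * fderiv ℝ (η z.1) z.2 (b i))
      + (∫ z, fderiv ℝ (φ z.1) z.2 c * ps z * η z.1 z.2) := by
    simp only [hAV]
    rw [integral_add (((iA1.fun_add iA2s).fun_add iA3s).fun_add iA4s) iA5,
      integral_add ((iA1.fun_add iA2s).fun_add iA3s) iA4s, integral_add (iA1.fun_add iA2s) iA3s,
      integral_add iA1 iA2s, integral_finsetSum _ (fun i _ => iA2 i),
      integral_finsetSum _ (fun i _ => iA3 i), integral_finsetSum _ (fun i _ => iA4 i)]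
  /- ### the duality passages -/
  -- time supports of the data: each datum carries a factor `us` or `ps`, hence lives in `S`
  have TSu : ∀ (D : ℝ × EuclideanSpace ℝ (Fin 3) → ℝ), (∀ z, z ∉ S → D z = 0) →
      ∀ᵐ z ∂(volume : Measure (ℝ × EuclideanSpace ℝ (Fin 3))), D z ≠ 0 → z.1 ∈ Icc 0 T :=
    fun D hD => Eventually.of_forall fun z hz => by
      by_contra h
      refine hz (hD z fun hzS => h ?_)
      exact Ioo_subset_Icc_self hzS.1
  have one_pos' : (0 : ℝ) < 1 := one_pos
  -- data integrability and supports
  have iF1 : Integrable (fun z : ℝ × EuclideanSpace ℝ (Fin 3) => (timeDeriv φ z.1 z.2 + (Δ (φ z.1)) z.2) * ⟪us z, c⟫) volume := by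
    have h := INT (cφt.add cφΔ) zφt (mu c) cone; simpa using h
  have iG2 : ∀ i, Integrable (fun z : ℝ × EuclideanSpace ℝ (Fin 3) => (2 * fderiv ℝ (φ z.1) z.2 (b i)) * ⟪us z, c⟫) volume := fun i => by
    have h := INT (Tc := fun z : ℝ × EuclideanSpace ℝ (Fin 3) => 2 * fderiv ℝ (φ z.1) z.2 (b i))
      (m := fun z => ⟪us z, c⟫) (X := fun _ => (1 : ℝ))
      (continuous_const.mul (cφi (b i))) (fun z hz => by simp only [zφi (b i) z hz, mul_zero]) (mu c) cone
    simpa using h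
  have iF3 : ∀ i, Integrable (fun z : ℝ × EuclideanSpace ℝ (Fin 3) =>
      fderiv ℝ (φ z.1) z.2 (b i) * (⟪us z, b i⟫ * ⟪us z, c⟫)) volume := fun i => by
    have h := INT (cφi (b i)) (zφi (b i)) (muu (b i) c) cone; simpa using h
  have iG4 : ∀ i, Integrable (fun z : ℝ × EuclideanSpace ℝ (Fin 3) => φ z.1 z.2 * (⟪us z, b i⟫ * ⟪us z, c⟫)) volume := fun i => by
    have h := INT cφ zφ (muu (b i) c) cone; simpa using h
  have iF5 : Integrable (fun z : ℝ × EuclideanSpace ℝ (Fin 3) => fderiv ℝ (φ z.1) z.2 c * ps z) volume := by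
    have h := INT (cφi c) (zφi c) mp cone; simpa using h
  have iG6 : Integrable (fun z : ℝ × EuclideanSpace ℝ (Fin 3) => φ z.1 z.2 * ps z) volume := by
    have h := INT cφ zφ mp cone; simpa using h
  have vF1 : ∀ z, z ∉ S → (timeDeriv φ z.1 z.2 + (Δ (φ z.1)) z.2) * ⟪us z, c⟫ = 0 := fun z hz => by
    simp only [hus0 z hz, inner_zero_left, mul_zero]
  have vG2 : ∀ i z, z ∉ S → (2 * fderiv ℝ (φ z.1) z.2 (b i)) * ⟪us z, c⟫ = 0 := fun i z hz => by
    simp only [hus0 z hz, inner_zero_left, mul_zero]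
  have vF3 : ∀ i z, z ∉ S → fderiv ℝ (φ z.1) z.2 (b i) * (⟪us z, b i⟫ * ⟪us z, c⟫) = 0 := fun i z hz => by
    simp only [hus0 z hz, inner_zero_left, mul_zero]
  have vG4 : ∀ i z, z ∉ S → φ z.1 z.2 * (⟪us z, b i⟫ * ⟪us z, c⟫) = 0 := fun i z hz => by
    simp only [hus0 z hz, inner_zero_left, mul_zero]
  have vF5 : ∀ z, z ∉ S → fderiv ℝ (φ z.1) z.2 c * ps z = 0 := fun z hz => by simp only [hps0 z hz, mul_zero]
  have vG6 : ∀ z, z ∉ S → φ z.1 z.2 * ps z = 0 := fun z hz => by simp only [hps0 z hz, mul_zero]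
  have P1 : ∫ z, (timeDeriv φ z.1 z.2 + (Δ (φ z.1)) z.2) * ⟪us z, c⟫ * η z.1 z.2 =
      ∫ w, θ w.1 w.2 * heatPotential 1 (fun z : ℝ × EuclideanSpace ℝ (Fin 3) =>
        (timeDeriv φ z.1 z.2 + (Δ (φ z.1)) z.2) * ⟪us z, c⟫) w := by
    rw [hη]; exact pairing_heatDuhamelBack_eq hθ one_pos' iF1 (TSu _ vF1)
  have P2 : ∀ i, ∫ z, (2 * fderiv ℝ (φ z.1) z.2 (b i)) * ⟪us z, c⟫ * fderiv ℝ (η z.1) z.2 (b i) =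
      ∫ w, θ w.1 w.2 * (-(multiplierHeatPotential 1 (derivSymbol (b i))
        (fun z : ℝ × EuclideanSpace ℝ (Fin 3) => (2 * fderiv ℝ (φ z.1) z.2 (b i)) * ⟪us z, c⟫) w).re) := fun i => by
    rw [hη]; exact pairing_fderiv_heatDuhamelBack_eq hθ one_pos' (iG2 i) (TSu _ (vG2 i)) (b i)
  have P3 : ∀ i, ∫ z, fderiv ℝ (φ z.1) z.2 (b i) * (⟪us z, b i⟫ * ⟪us z, c⟫) * η z.1 z.2 =
      ∫ w, θ w.1 w.2 * heatPotential 1 (fun z : ℝ × EuclideanSpace ℝ (Fin 3) =>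
        fderiv ℝ (φ z.1) z.2 (b i) * (⟪us z, b i⟫ * ⟪us z, c⟫)) w := fun i => by
    rw [hη]; exact pairing_heatDuhamelBack_eq hθ one_pos' (iF3 i) (TSu _ (vF3 i))
  have P4 : ∀ i, ∫ z, φ z.1 z.2 * (⟪us z, b i⟫ * ⟪us z, c⟫) * fderiv ℝ (η z.1) z.2 (b i) =
      ∫ w, θ w.1 w.2 * (-(multiplierHeatPotential 1 (derivSymbol (b i))
        (fun z : ℝ × EuclideanSpace ℝ (Fin 3) => φ z.1 z.2 * (⟪us z, b i⟫ * ⟪us z, c⟫)) w).re) := fun i => by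
    rw [hη]; exact pairing_fderiv_heatDuhamelBack_eq hθ one_pos' (iG4 i) (TSu _ (vG4 i)) (b i)
  have P5 : ∫ z, fderiv ℝ (φ z.1) z.2 c * ps z * η z.1 z.2 =
      ∫ w, θ w.1 w.2 * heatPotential 1 (fun z : ℝ × EuclideanSpace ℝ (Fin 3) => fderiv ℝ (φ z.1) z.2 c * ps z) w := by
    rw [hη]; exact pairing_heatDuhamelBack_eq hθ one_pos' iF5 (TSu _ vF5)
  have P6' : ∫ z, P6 z =
      ∫ w, θ w.1 w.2 * (-(multiplierHeatPotential 1 (derivSymbol c)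
        (fun z : ℝ × EuclideanSpace ℝ (Fin 3) => φ z.1 z.2 * ps z) w).re) := by
    simp only [hP6]
    rw [hη]; exact pairing_fderiv_heatDuhamelBack_eq hθ one_pos' iG6 (TSu _ vG6) c
  -- the datum pairing
  have hφ0c : HasCompactSupport (φ 0) := hφ.hasCompactSupport_slice 0
  have hGb' : ∀ x, ‖G x‖ ≤ M₀ * ‖c‖ := fun x => by
    simp only [hG]
    rw [← real_inner_smul_left]
    exact (norm_inner_le_norm _ _).trans (mul_le_mul_of_nonneg_right (hu₀b x) (norm_nonneg _))
  have hGi : Integrable G volume := by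
    have hGm : AEStronglyMeasurable G volume :=
      ((hφ.contDiff_slice 0).continuous.aestronglyMeasurable).mul (hu₀.inner_const (c := c))
    have hsupp : support G ⊆ tsupport (φ 0) := fun x hx => by
      by_contra h
      exact hx (by simp only [hG, image_eq_zero_of_notMem_tsupport h, zero_mul])
    rw [← integrableOn_iff_integrable_of_support_subset hsupp]
    haveI : IsFiniteMeasure (volume.restrict (tsupport (φ 0))) :=
      ⟨by rw [Measure.restrict_apply_univ]; exact hφ0c.isCompact.measure_lt_top⟩
    exact Integrable.of_bound hGm.restrict (M₀ * ‖c‖) (Eventually.of_forall hGb')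
  have P7 : ∫ x, G x * η 0 x =
      ∫ w : ℝ × EuclideanSpace ℝ (Fin 3), θ w.1 w.2 * (if 0 < w.1 then heatExtension G w.1 w.2 else 0) := by
    rw [hη]; exact integral_mul_heatDuhamelBack_zero_eq hθ hGi hGb'
  /- ### conclusion -/
  have hL : ∫ z in S, θ z.1 z.2 * (φ z.1 z.2 * ⟪u z.1 z.2, c⟫) = ∫ z, LH z := by
    rw [← setIntegral_eq_integral_of_forall_compl_eq_zero (s := S) (fun z hz => vLH z hz)]
    refine integral_congr_ae ?_
    rw [EventuallyEq, ae_restrict_iff' hSm]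
    filter_upwards [hus] with z hzu hzS
    simp only [hLH, hzu hzS]; ring
  rw [hL, main, hA, P1, P5, P6', P7]
  simp only [P2, P3, P4]

/-- A locally integrable function times a test function is integrable. [folklore] -/
private theorem integrable_test_mul {P : ℝ × EuclideanSpace ℝ (Fin 3) → ℝ} (hP : LocallyIntegrable P volume)
    {θ : ℝ → EuclideanSpace ℝ (Fin 3) → ℝ}
    (hθ : IsSpaceTimeTestOn (⊤ : Opens (ℝ × EuclideanSpace ℝ (Fin 3))) θ) :
    Integrable (fun w : ℝ × EuclideanSpace ℝ (Fin 3) => θ w.1 w.2 * P w) volume := by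
  have h := hP.integrable_smul_left_of_hasCompactSupport hθ.contDiff.continuous hθ.hasCompactSupport
  simpa [smul_eq_mul, uncurry] using h

/-! ### The representation almost everywhere -/

set_option maxHeartbeats 3200000 in
/-- **The localised Duhamel formula from the initial time** (the print's `u = u₁ + u₂ + u₃` near
`t = 0`, arXiv p. 9, for the localised field `φu`, module docstring). Under the hypotheses of
`duhamel_identity_datum_tested`, for a.e. `(t, x) ∈ (0,T) × ℝ³`,
`φ u_c = W₊⊛[(∂ₜφ+Δφ)us_c] + ∑ᵢ(-Re σᵢ(D)W₊⊛[2∂ᵢφ us_c]) + ∑ᵢ W₊⊛[∂ᵢφ usᵢus_c] + ∑ᵢ(-Re σᵢ(D)W₊⊛[φusᵢus_c])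
 + W₊⊛[∂_cφ ps] - Re σ_c(D)W₊⊛[φ ps] + 1_{t>0} e^{tΔ}(φ(0)u₀_c)`
(du Bois-Reymond on the tested identity; the potentials are locally integrable).
[cite: JiaSverak2014, §3 proof of Thm. 3.2 (arXiv p. 9)] -/
theorem duhamel_representation_datum {T : ℝ}
    {u : ℝ → (EuclideanSpace ℝ (Fin 3)) → (EuclideanSpace ℝ (Fin 3))} {p : ℝ → (EuclideanSpace ℝ (Fin 3)) → ℝ}
    {u₀ : (EuclideanSpace ℝ (Fin 3)) → (EuclideanSpace ℝ (Fin 3))}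
    {us : ℝ × (EuclideanSpace ℝ (Fin 3)) → (EuclideanSpace ℝ (Fin 3))} {ps : ℝ × (EuclideanSpace ℝ (Fin 3)) → ℝ}
    (hus : ∀ᵐ z ∂(volume : Measure (ℝ × EuclideanSpace ℝ (Fin 3))),
      z ∈ Ioo 0 T ×ˢ (univ : Set (EuclideanSpace ℝ (Fin 3))) → us z = u z.1 z.2)
    (hus0 : ∀ z, z ∉ Ioo 0 T ×ˢ (univ : Set (EuclideanSpace ℝ (Fin 3))) → us z = 0)
    (husi : LocallyIntegrable us volume) (hus2 : LocallyIntegrable (fun z => ‖us z‖ ^ 2) volume)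
    (hps : ∀ᵐ z ∂(volume : Measure (ℝ × EuclideanSpace ℝ (Fin 3))),
      z ∈ Ioo 0 T ×ˢ (univ : Set (EuclideanSpace ℝ (Fin 3))) → ps z = p z.1 z.2)
    (hps0 : ∀ z, z ∉ Ioo 0 T ×ˢ (univ : Set (EuclideanSpace ℝ (Fin 3))) → ps z = 0)
    (hpsi : LocallyIntegrable ps volume)
    (hweak : ∀ ψ : ℝ → (EuclideanSpace ℝ (Fin 3)) → (EuclideanSpace ℝ (Fin 3)),
      IsSpaceTimeTestOn (slab (EuclideanSpace ℝ (Fin 3)) (Iio T) isOpen_Iio) ψ →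
      (∫ t in Ioo 0 T, ∫ x, (⟪u t x, timeDeriv ψ t x⟫ + ⟪u t x, convect (u t) (ψ t) x⟫ +
          1 * ⟪u t x, Δ (ψ t) x⟫ + p t x * VectorCalculus.divergence (ψ t) x)) +
        ∫ x, ⟪u₀ x, ψ 0 x⟫ = 0)
    (hu₀ : AEStronglyMeasurable u₀ volume)
    {φ : ℝ → (EuclideanSpace ℝ (Fin 3)) → ℝ} (hφ : IsSpaceTimeTestOn (slab (EuclideanSpace ℝ (Fin 3)) (Iio T) isOpen_Iio) φ)
    {M₀ : ℝ} (hu₀b : ∀ x, ‖φ 0 x • u₀ x‖ ≤ M₀) (c : EuclideanSpace ℝ (Fin 3)) :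
    ∀ᵐ z ∂(volume.restrict (Ioo 0 T ×ˢ (univ : Set (EuclideanSpace ℝ (Fin 3))))),
      φ z.1 z.2 * ⟪u z.1 z.2, c⟫ =
        heatPotential 1 (fun z : ℝ × EuclideanSpace ℝ (Fin 3) =>
            (timeDeriv φ z.1 z.2 + (Δ (φ z.1)) z.2) * ⟪us z, c⟫) z
        + ∑ i, (-(multiplierHeatPotential 1 (derivSymbol (EuclideanSpace.basisFun (Fin 3) ℝ i))
            (fun z : ℝ × EuclideanSpace ℝ (Fin 3) =>
              (2 * fderiv ℝ (φ z.1) z.2 (EuclideanSpace.basisFun (Fin 3) ℝ i)) * ⟪us z, c⟫) z).re)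
        + ∑ i, heatPotential 1 (fun z : ℝ × EuclideanSpace ℝ (Fin 3) =>
            fderiv ℝ (φ z.1) z.2 (EuclideanSpace.basisFun (Fin 3) ℝ i) *
              (⟪us z, EuclideanSpace.basisFun (Fin 3) ℝ i⟫ * ⟪us z, c⟫)) z
        + ∑ i, (-(multiplierHeatPotential 1 (derivSymbol (EuclideanSpace.basisFun (Fin 3) ℝ i))
            (fun z : ℝ × EuclideanSpace ℝ (Fin 3) =>
              φ z.1 z.2 * (⟪us z, EuclideanSpace.basisFun (Fin 3) ℝ i⟫ * ⟪us z, c⟫)) z).re)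
        + heatPotential 1 (fun z : ℝ × EuclideanSpace ℝ (Fin 3) => fderiv ℝ (φ z.1) z.2 c * ps z) z
        + (-(multiplierHeatPotential 1 (derivSymbol c) (fun z : ℝ × EuclideanSpace ℝ (Fin 3) => φ z.1 z.2 * ps z) z).re)
        + (if 0 < z.1 then heatExtension (fun y => φ 0 y * ⟪u₀ y, c⟫) z.1 z.2 else 0) := by
  classical
  set b : OrthonormalBasis (Fin 3) ℝ (EuclideanSpace ℝ (Fin 3)) := EuclideanSpace.basisFun (Fin 3) ℝ with hb_def
  set S : Set (ℝ × EuclideanSpace ℝ (Fin 3)) := Ioo 0 T ×ˢ (univ : Set (EuclideanSpace ℝ (Fin 3))) with hS_def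
  have hSm : MeasurableSet S := measurableSet_Ioo.prod MeasurableSet.univ
  set K : Set (ℝ × EuclideanSpace ℝ (Fin 3)) := tsupport (uncurry φ) with hK_def
  have hK : IsCompact K := hφ.hasCompactSupport
  /- ### continuity, vanishing, monomials (as in the tested identity) -/
  have cφ : Continuous fun z : ℝ × EuclideanSpace ℝ (Fin 3) => φ z.1 z.2 := hφ.contDiff.continuous
  have cφt : Continuous fun z : ℝ × EuclideanSpace ℝ (Fin 3) => timeDeriv φ z.1 z.2 := hφ.continuous_timeDeriv
  have cφΔ : Continuous fun z : ℝ × EuclideanSpace ℝ (Fin 3) => (Δ (φ z.1)) z.2 := by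
    have h := ((hφ.isSmoothSpaceTimeOn univ).laplacian uniqueDiffOn_univ).continuousOn
    rw [univ_prod_univ, continuousOn_univ] at h
    exact h
  have cφi : ∀ v : EuclideanSpace ℝ (Fin 3),
      Continuous fun z : ℝ × EuclideanSpace ℝ (Fin 3) => fderiv ℝ (φ z.1) z.2 v := fun v =>
    continuous_fderiv_slice_of_contDiff hφ.contDiff v
  have cone : Continuous fun _ : ℝ × EuclideanSpace ℝ (Fin 3) => (1 : ℝ) := continuous_const
  have zφ : ∀ z : ℝ × EuclideanSpace ℝ (Fin 3), z ∉ K → φ z.1 z.2 = 0 := fun z hz =>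
    show uncurry φ z = 0 from image_eq_zero_of_notMem_tsupport hz
  have zφt : ∀ z : ℝ × EuclideanSpace ℝ (Fin 3), z ∉ K → timeDeriv φ z.1 z.2 + (Δ (φ z.1)) z.2 = 0 :=
    fun z hz => by
    rw [IsSpaceTimeTestOn.timeDeriv_eq_zero_of_notMem hz, laplacian_slice_eq_zero_of_notMem_tsupport hz,
      add_zero]
  have zφi : ∀ (v : EuclideanSpace ℝ (Fin 3)) (z : ℝ × EuclideanSpace ℝ (Fin 3)), z ∉ K →
      fderiv ℝ (φ z.1) z.2 v = 0 := fun v z hz => by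
    rw [IsSpaceTimeTestOn.fderiv_slice_eq_zero_of_notMem hz]; rfl
  have mu : ∀ a : EuclideanSpace ℝ (Fin 3),
      IntegrableOn (fun z : ℝ × EuclideanSpace ℝ (Fin 3) => ⟪us z, a⟫) K volume := fun a =>
    (husi.integrableOn_isCompact hK).inner_const a
  have muu : ∀ a a' : EuclideanSpace ℝ (Fin 3), IntegrableOn
      (fun z : ℝ × EuclideanSpace ℝ (Fin 3) => ⟪us z, a⟫ * ⟪us z, a'⟫) K volume := by
    intro a a'
    have hm : AEStronglyMeasurable (fun z : ℝ × EuclideanSpace ℝ (Fin 3) => ⟪us z, a⟫ * ⟪us z, a'⟫)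
        (volume.restrict K) := by
      have h := (husi.integrableOn_isCompact hK).aestronglyMeasurable
      exact (h.inner_const (c := a)).mul (h.inner_const (c := a'))
    refine (((hus2.integrableOn_isCompact hK)).const_mul (‖a‖ * ‖a'‖)).mono' hm
      (Eventually.of_forall fun z => ?_)
    rw [norm_mul]
    calc ‖(⟪us z, a⟫ : ℝ)‖ * ‖(⟪us z, a'⟫ : ℝ)‖ ≤ (‖us z‖ * ‖a‖) * (‖us z‖ * ‖a'‖) :=
          mul_le_mul (norm_inner_le_norm _ _) (norm_inner_le_norm _ _) (norm_nonneg _) (by positivity)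
      _ = ‖a‖ * ‖a'‖ * ‖us z‖ ^ 2 := by ring
  have mp : IntegrableOn ps K volume := hpsi.integrableOn_isCompact hK
  have INT : ∀ {Tc m X : ℝ × EuclideanSpace ℝ (Fin 3) → ℝ}, Continuous Tc → (∀ z, z ∉ K → Tc z = 0) →
      IntegrableOn m K volume → Continuous X →
      Integrable (fun z => Tc z * m z * X z) volume := by
    intro Tc m X hTc hTc0 hm hX
    have h := integrableOn_test_mul_mul (⊤ : Opens (ℝ × EuclideanSpace ℝ (Fin 3))) hK hTc hTc0 hm hX
    rwa [TopologicalSpace.Opens.coe_top, integrableOn_univ] at h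
  /- ### the data: integrability and supports -/
  have TSu : ∀ (D : ℝ × EuclideanSpace ℝ (Fin 3) → ℝ), (∀ z, z ∉ S → D z = 0) →
      ∀ᵐ z ∂(volume : Measure (ℝ × EuclideanSpace ℝ (Fin 3))), D z ≠ 0 → z.1 ∈ Icc 0 T :=
    fun D hD => Eventually.of_forall fun z hz => by
      by_contra h
      refine hz (hD z fun hzS => h ?_)
      exact Ioo_subset_Icc_self hzS.1
  set F1 : ℝ × EuclideanSpace ℝ (Fin 3) → ℝ := fun z => (timeDeriv φ z.1 z.2 + (Δ (φ z.1)) z.2) * ⟪us z, c⟫ with hF1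
  set G2 : Fin 3 → ℝ × EuclideanSpace ℝ (Fin 3) → ℝ := fun i z => (2 * fderiv ℝ (φ z.1) z.2 (b i)) * ⟪us z, c⟫ with hG2
  set F3 : Fin 3 → ℝ × EuclideanSpace ℝ (Fin 3) → ℝ := fun i z =>
    fderiv ℝ (φ z.1) z.2 (b i) * (⟪us z, b i⟫ * ⟪us z, c⟫) with hF3
  set G4 : Fin 3 → ℝ × EuclideanSpace ℝ (Fin 3) → ℝ := fun i z => φ z.1 z.2 * (⟪us z, b i⟫ * ⟪us z, c⟫) with hG4
  set F5 : ℝ × EuclideanSpace ℝ (Fin 3) → ℝ := fun z => fderiv ℝ (φ z.1) z.2 c * ps z with hF5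
  set G6 : ℝ × EuclideanSpace ℝ (Fin 3) → ℝ := fun z => φ z.1 z.2 * ps z with hG6
  set G : (EuclideanSpace ℝ (Fin 3)) → ℝ := fun y => φ 0 y * ⟪u₀ y, c⟫ with hG
  have iF1 : Integrable F1 volume := by
    have h := INT (cφt.add cφΔ) zφt (mu c) cone; simpa [hF1] using h
  have iG2 : ∀ i, Integrable (G2 i) volume := fun i => by
    have h := INT (Tc := fun z : ℝ × EuclideanSpace ℝ (Fin 3) => 2 * fderiv ℝ (φ z.1) z.2 (b i))
      (m := fun z => ⟪us z, c⟫) (X := fun _ => (1 : ℝ))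
      (continuous_const.mul (cφi (b i))) (fun z hz => by simp only [zφi (b i) z hz, mul_zero]) (mu c) cone
    simpa [hG2] using h
  have iF3 : ∀ i, Integrable (F3 i) volume := fun i => by
    have h := INT (cφi (b i)) (zφi (b i)) (muu (b i) c) cone; simpa [hF3] using h
  have iG4 : ∀ i, Integrable (G4 i) volume := fun i => by
    have h := INT cφ zφ (muu (b i) c) cone; simpa [hG4] using h
  have iF5 : Integrable F5 volume := by
    have h := INT (cφi c) (zφi c) mp cone; simpa [hF5] using h
  have iG6 : Integrable G6 volume := by
    have h := INT cφ zφ mp cone; simpa [hG6] using h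
  have vF1 : ∀ z, z ∉ S → F1 z = 0 := fun z hz => by simp only [hF1, hus0 z hz, inner_zero_left, mul_zero]
  have vG2 : ∀ i z, z ∉ S → G2 i z = 0 := fun i z hz => by simp only [hG2, hus0 z hz, inner_zero_left, mul_zero]
  have vF3 : ∀ i z, z ∉ S → F3 i z = 0 := fun i z hz => by simp only [hF3, hus0 z hz, inner_zero_left, mul_zero]
  have vG4 : ∀ i z, z ∉ S → G4 i z = 0 := fun i z hz => by simp only [hG4, hus0 z hz, inner_zero_left, mul_zero]
  have vF5 : ∀ z, z ∉ S → F5 z = 0 := fun z hz => by simp only [hF5, hps0 z hz, mul_zero]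
  have vG6 : ∀ z, z ∉ S → G6 z = 0 := fun z hz => by simp only [hG6, hps0 z hz, mul_zero]
  /- ### local integrability of the potentials -/
  have one_pos' : (0 : ℝ) < 1 := one_pos
  have hKh := (isSliceBoundKernel_backKernel_heatKernel (E := EuclideanSpace ℝ (Fin 3))).timeScale one_pos'
  have LIh : ∀ (D : ℝ × EuclideanSpace ℝ (Fin 3) → ℝ), Integrable D volume → (∀ z, z ∉ S → D z = 0) →
      LocallyIntegrable (fun w => heatPotential 1 D w) volume := by
    intro D hD hD0
    have h : LocallyIntegrable (fun w => ((fun v => backKernel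
        (fun a y => UnboundedOperators.heatKernel (E := EuclideanSpace ℝ (Fin 3)) (1 * a) y) (-v))
        ⋆[ContinuousLinearMap.lsmul ℝ ℝ, (volume : Measure (ℝ × EuclideanSpace ℝ (Fin 3)))] D) w) volume :=
      hKh.locallyIntegrable_convolution_reflect hD (TSu D hD0)
    simp only [convolution_reflect_backKernel_heatKernel] at h
    exact h
  have LIg : ∀ (v : EuclideanSpace ℝ (Fin 3)) (D : ℝ × EuclideanSpace ℝ (Fin 3) → ℝ), Integrable D volume →
      (∀ z, z ∉ S → D z = 0) →
      LocallyIntegrable (fun w => -(multiplierHeatPotential 1 (derivSymbol v) D w).re) volume := by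
    intro v D hD hD0
    have hKg := (isSliceBoundKernel_backKernel_heatKernelGrad (E := EuclideanSpace ℝ (Fin 3)) v).timeScale one_pos'
    have h : LocallyIntegrable (fun w => ((fun q => backKernel (fun a y => heatKernelGrad v (1 * a) y) (-q))
        ⋆[ContinuousLinearMap.lsmul ℝ ℝ, (volume : Measure (ℝ × EuclideanSpace ℝ (Fin 3)))] D) w) volume :=
      hKg.locallyIntegrable_convolution_reflect hD (TSu D hD0)
    simp only [convolution_reflect_backKernel_heatKernelGrad one_pos'] at h
    exact h
  -- the datum term
  have hφ0c : HasCompactSupport (φ 0) := hφ.hasCompactSupport_slice 0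
  have hGb' : ∀ x, ‖G x‖ ≤ M₀ * ‖c‖ := fun x => by
    simp only [hG]
    rw [← real_inner_smul_left]
    exact (norm_inner_le_norm _ _).trans (mul_le_mul_of_nonneg_right (hu₀b x) (norm_nonneg _))
  have hGm : AEStronglyMeasurable G volume :=
    ((hφ.contDiff_slice 0).continuous.aestronglyMeasurable).mul (hu₀.inner_const (c := c))
  have hGi : Integrable G volume := by
    have hsupp : support G ⊆ tsupport (φ 0) := fun x hx => by
      by_contra h
      exact hx (by simp only [hG, image_eq_zero_of_notMem_tsupport h, zero_mul])
    rw [← integrableOn_iff_integrable_of_support_subset hsupp]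
    haveI : IsFiniteMeasure (volume.restrict (tsupport (φ 0))) :=
      ⟨by rw [Measure.restrict_apply_univ]; exact hφ0c.isCompact.measure_lt_top⟩
    exact Integrable.of_bound hGm.restrict (M₀ * ‖c‖) (Eventually.of_forall hGb')
  set V : ℝ × EuclideanSpace ℝ (Fin 3) → ℝ := fun w => if 0 < w.1 then heatExtension G w.1 w.2 else 0 with hV
  have hVind : V = (Ioi (0 : ℝ) ×ˢ (univ : Set (EuclideanSpace ℝ (Fin 3)))).indicator
      (fun w => heatExtension G w.1 w.2) := by
    funext w
    by_cases hw : 0 < w.1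
    · rw [hV]; simp only [hw, if_true]
      rw [indicator_of_mem (show w ∈ Ioi (0 : ℝ) ×ˢ (univ : Set (EuclideanSpace ℝ (Fin 3))) from ⟨hw, mem_univ _⟩)]
    · rw [hV]; simp only [hw, if_false]
      rw [indicator_of_notMem (fun h => hw h.1)]
  have hVm : AEStronglyMeasurable V volume := by
    rw [hVind, aestronglyMeasurable_indicator_iff (measurableSet_Ioi.prod MeasurableSet.univ)]
    have hGmem : MemLp G 1 (volume : Measure (EuclideanSpace ℝ (Fin 3))) := memLp_one_iff_integrable.2 hGi
    exact (contDiffOn_heatExtension_prod hGmem le_rfl).continuousOn.aestronglyMeasurable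
      (measurableSet_Ioi.prod MeasurableSet.univ)
  have hVb : ∀ w, ‖V w‖ ≤ M₀ * ‖c‖ := fun w => by
    by_cases hw : 0 < w.1
    · rw [hV]; simp only [hw, if_true]; exact norm_heatExtension_le hGb' hw w.2
    · rw [hV]; simp only [hw, if_false, norm_zero]; exact (norm_nonneg _).trans (hGb' 0)
  have LIV : LocallyIntegrable V volume :=
    (memLp_top_of_bound hVm (M₀ * ‖c‖) (Eventually.of_forall hVb)).locallyIntegrable le_top
  /- ### the representative and its local integrability -/
  set Rep : ℝ × EuclideanSpace ℝ (Fin 3) → ℝ := fun w =>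
    heatPotential 1 F1 w + ∑ i, (-(multiplierHeatPotential 1 (derivSymbol (b i)) (G2 i) w).re)
      + ∑ i, heatPotential 1 (F3 i) w + ∑ i, (-(multiplierHeatPotential 1 (derivSymbol (b i)) (G4 i) w).re)
      + heatPotential 1 F5 w + (-(multiplierHeatPotential 1 (derivSymbol c) G6 w).re) + V w with hRep
  have lP1 : LocallyIntegrable (fun w => heatPotential 1 F1 w) volume := LIh F1 iF1 vF1
  have lP2 : ∀ i, LocallyIntegrable (fun w => -(multiplierHeatPotential 1 (derivSymbol (b i)) (G2 i) w).re) volume :=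
    fun i => LIg (b i) (G2 i) (iG2 i) (vG2 i)
  have lP3 : ∀ i, LocallyIntegrable (fun w => heatPotential 1 (F3 i) w) volume := fun i => LIh (F3 i) (iF3 i) (vF3 i)
  have lP4 : ∀ i, LocallyIntegrable (fun w => -(multiplierHeatPotential 1 (derivSymbol (b i)) (G4 i) w).re) volume :=
    fun i => LIg (b i) (G4 i) (iG4 i) (vG4 i)
  have lP5 : LocallyIntegrable (fun w => heatPotential 1 F5 w) volume := LIh F5 iF5 vF5
  have lP6 : LocallyIntegrable (fun w => -(multiplierHeatPotential 1 (derivSymbol c) G6 w).re) volume := LIg c G6 iG6 vG6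
  have lP2s : LocallyIntegrable (fun w => ∑ i, (-(multiplierHeatPotential 1 (derivSymbol (b i)) (G2 i) w).re)) volume :=
    locallyIntegrable_finsetSum _ fun i _ => lP2 i
  have lP3s : LocallyIntegrable (fun w => ∑ i, heatPotential 1 (F3 i) w) volume :=
    locallyIntegrable_finsetSum _ fun i _ => lP3 i
  have lP4s : LocallyIntegrable (fun w => ∑ i, (-(multiplierHeatPotential 1 (derivSymbol (b i)) (G4 i) w).re)) volume :=
    locallyIntegrable_finsetSum _ fun i _ => lP4 i
  have lRep : LocallyIntegrable Rep volume :=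
    (((((lP1.add lP2s).add lP3s).add lP4s).add lP5).add lP6).add LIV
  -- the left-hand side `φ us_c`
  set LH0 : ℝ × EuclideanSpace ℝ (Fin 3) → ℝ := fun z => φ z.1 z.2 * ⟪us z, c⟫ with hLH0
  have lLH0 : LocallyIntegrable LH0 volume := by
    rw [locallyIntegrable_iff]
    intro k hk
    exact IntegrableOn.continuousOn_mul cφ.continuousOn ((husi.integrableOn_isCompact hk).inner_const c) hk
  /- ### du Bois-Reymond -/
  have hzero : ∀ᵐ w ∂(volume : Measure (ℝ × EuclideanSpace ℝ (Fin 3))), LH0 w - Rep w = 0 := by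
    refine ae_eq_zero_of_integral_contDiff_smul_eq_zero (lLH0.sub lRep) fun g hgs hgc => ?_
    have hθ : IsSpaceTimeTestOn (⊤ : Opens (ℝ × EuclideanSpace ℝ (Fin 3))) fun t x => g (t, x) :=
      Carleman.isSpaceTimeTestOn_top_curry hgs hgc
    have key := duhamel_identity_datum_tested hus hus0 husi hus2 hps hps0 hpsi hweak hu₀ hφ hu₀b c hθ
    -- left-hand side as a whole-space integral
    have hL : ∫ z in S, g (z.1, z.2) * (φ z.1 z.2 * ⟪u z.1 z.2, c⟫) = ∫ z, g z * LH0 z := by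
      have v0 : ∀ z, z ∉ S → g z * LH0 z = 0 := fun z hz => by
        simp only [hLH0, hus0 z hz, inner_zero_left, mul_zero]
      rw [← setIntegral_eq_integral_of_forall_compl_eq_zero (s := S) (fun z hz => v0 z hz)]
      refine integral_congr_ae ?_
      rw [EventuallyEq, ae_restrict_iff' hSm]
      filter_upwards [hus] with z hzu hzS
      simp only [hLH0, hzu hzS, Prod.mk.eta]
    -- right-hand side as a whole-space integral
    have I1 := integrable_test_mul lP1 hθ
    have I2 : ∀ i, Integrable (fun w : ℝ × EuclideanSpace ℝ (Fin 3) =>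
        g (w.1, w.2) * (-(multiplierHeatPotential 1 (derivSymbol (b i)) (G2 i) w).re)) volume :=
      fun i => integrable_test_mul (lP2 i) hθ
    have I3 : ∀ i, Integrable (fun w : ℝ × EuclideanSpace ℝ (Fin 3) => g (w.1, w.2) * heatPotential 1 (F3 i) w) volume :=
      fun i => integrable_test_mul (lP3 i) hθ
    have I4 : ∀ i, Integrable (fun w : ℝ × EuclideanSpace ℝ (Fin 3) =>
        g (w.1, w.2) * (-(multiplierHeatPotential 1 (derivSymbol (b i)) (G4 i) w).re)) volume :=
      fun i => integrable_test_mul (lP4 i) hθ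
    have I5 := integrable_test_mul lP5 hθ
    have I6 := integrable_test_mul lP6 hθ
    have I7 := integrable_test_mul LIV hθ
    have hR : ∫ w, g w * Rep w =
        (∫ w : ℝ × EuclideanSpace ℝ (Fin 3), g (w.1, w.2) * heatPotential 1 F1 w)
        + (∑ i, ∫ w : ℝ × EuclideanSpace ℝ (Fin 3), g (w.1, w.2) *
            (-(multiplierHeatPotential 1 (derivSymbol (b i)) (G2 i) w).re))
        + (∑ i, ∫ w : ℝ × EuclideanSpace ℝ (Fin 3), g (w.1, w.2) * heatPotential 1 (F3 i) w)
        + (∑ i, ∫ w : ℝ × EuclideanSpace ℝ (Fin 3), g (w.1, w.2) *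
            (-(multiplierHeatPotential 1 (derivSymbol (b i)) (G4 i) w).re))
        + (∫ w : ℝ × EuclideanSpace ℝ (Fin 3), g (w.1, w.2) * heatPotential 1 F5 w)
        + (∫ w : ℝ × EuclideanSpace ℝ (Fin 3), g (w.1, w.2) * (-(multiplierHeatPotential 1 (derivSymbol c) G6 w).re))
        + (∫ w : ℝ × EuclideanSpace ℝ (Fin 3), g (w.1, w.2) * V w) := by
      have e : ∀ w : ℝ × EuclideanSpace ℝ (Fin 3), g w * Rep w =
          g (w.1, w.2) * heatPotential 1 F1 w
          + ∑ i, g (w.1, w.2) * (-(multiplierHeatPotential 1 (derivSymbol (b i)) (G2 i) w).re)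
          + ∑ i, g (w.1, w.2) * heatPotential 1 (F3 i) w
          + ∑ i, g (w.1, w.2) * (-(multiplierHeatPotential 1 (derivSymbol (b i)) (G4 i) w).re)
          + g (w.1, w.2) * heatPotential 1 F5 w
          + g (w.1, w.2) * (-(multiplierHeatPotential 1 (derivSymbol c) G6 w).re)
          + g (w.1, w.2) * V w := fun w => by
        simp only [hRep, Prod.mk.eta, mul_add, Finset.mul_sum]
      simp_rw [e]
      have I2s := integrable_finsetSum (Finset.univ) fun i _ => I2 i
      have I3s := integrable_finsetSum (Finset.univ) fun i _ => I3 i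
      have I4s := integrable_finsetSum (Finset.univ) fun i _ => I4 i
      rw [integral_add (((((I1.fun_add I2s).fun_add I3s).fun_add I4s).fun_add I5).fun_add I6) I7,
        integral_add ((((I1.fun_add I2s).fun_add I3s).fun_add I4s).fun_add I5) I6,
        integral_add (((I1.fun_add I2s).fun_add I3s).fun_add I4s) I5,
        integral_add ((I1.fun_add I2s).fun_add I3s) I4s, integral_add (I1.fun_add I2s) I3s,
        integral_add I1 I2s, integral_finsetSum _ (fun i _ => I2 i), integral_finsetSum _ (fun i _ => I3 i),
        integral_finsetSum _ (fun i _ => I4 i)]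
    have hkey : ∫ z, g z * LH0 z = ∫ w, g w * Rep w := by
      rw [← hL, hR]
      exact key
    have hint : ∫ w, g w • (LH0 w - Rep w) = (∫ z, g z * LH0 z) - ∫ w, g w * Rep w := by
      simp only [smul_eq_mul, mul_sub]
      exact integral_sub (integrable_test_mul lLH0 hθ) (integrable_test_mul lRep hθ)
    rw [hint, hkey, sub_self]
  -- conclusion on the slab
  rw [ae_restrict_iff' hSm]
  filter_upwards [hzero, hus] with z hz hzu hzS
  have e : φ z.1 z.2 * ⟪u z.1 z.2, c⟫ = LH0 z := by simp only [hLH0, hzu hzS]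
  rw [e, ← sub_eq_zero]
  simpa only [hRep] using hz

end JiaSverak2014

end Literature.Analysis.FluidPDE

end
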